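import Summits.QuantumFields.BalabanUV.Beta.FP.HorizontalBookkeepingTailSum

/-!
# `BalabanUV.Beta.FP.HorizontalBookkeepingTailLetters` — road «FP», N7 H-route, row H3-BOOK (b-T): THE LETTERS INTERFACE — the tail transport
# comparison from ABSTRACT SCALED ℓ¹ LETTERS `Σ'|w| ≤ ℓ₀/N`, `Σ'(|x|₁+1)|w| ≤ ℓ₁`, `Σ'(|x|₁+1)⁷|w| ≤ ℓ₇·N⁶` (what (b-T) actually consumes), and a SECOND
# supplier: the exponentially weighted ℓ¹ profile `Σ_x e^{(δ/N)|x|₁}|w κ l x| ≤ c/N` ([folklore] lattice bookkeeping; nothing of the manuscripts)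

HONEST DEPENDENCY (page 1, mandatory): continuum YM on T⁴ ⇐ BetaPertH ∧ nine spine estimates (0/9 proved); BetaPertH ⇐ (D1) ∧ (D4) ∧
CAP+tail; G-an2-4 gates asym, D1 and NE2/3/4.  HONEST FRAMING (cell contract, verbatim): «discharging `BetaPertH` makes Bałaban's UV
stability UNCONDITIONAL — a real constructive-QFT result; it is NOT the continuum limit and NOT the Clay problem.»  THIS MODULE re-packages BY NAME
`FP/HorizontalBookkeepingTailPointwise.abs_transport_tail_sub_le_of_letters` and `FP/HorizontalBookkeepingTailSum.summable_of_quintic`; every analytic input is a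
HYPOTHESIS displayed in the signatures; it cites nothing, defines nothing, mints no `Prop` fact, 0 sorry.  WHY: the (b-T) chain (p230400/p230891/p231355) was
stated for the SUP profile `|w κ l x| ≤ (c/N⁵)e^{−(δ/N)|x|₁}` whose mass exponent `p = 5` is row IPROF-UNIF's LOCATED, not landed, power (p229339 has `p = 1`;
gan24-leaf-04-g37's note: the ℓ¹ masses `Σ|w| ≍ N⁻¹`, `Σ|u||w| ≍ 1` are what (H3-b) needs and are NOT reachable by the fibre sup-bound route).  The comparison
only ever uses three ℓ¹-type LETTERS with the scalings `N⁻¹, N⁰, N⁶`; this file states the result from them, so that IPROF-UNIF may deliver EITHER a sup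
profile OR — the natural currency of a composition-law induction over scales, being sub-multiplicative — an exponentially WEIGHTED ℓ¹ bound.  NOT (b3′)/(b4′),
NOT `hbook`, NOT `hasym`, NOT D1, NOT BetaPertH, NOT continuum, NOT Clay.

CONTENT.
* §1 `letter_of_expL1`: `Σ'_x e^{(δ/N)|x|₁}|w x| ≤ c/N` (`δ > 0`, `N ≥ 1`) ⟹ `Σ'_x (|x|₁+1)^k|w x| ≤ c·(k!·e^{δ}/δ^k)·N^k/N` (pointwise
  `(L+1)^k ≤ (k!e^a/a^k)·e^{aL}`, `a = δ/N ≤ δ`); `scaledLetters_of_supProfile` (the sup profile `p = 5` gives the scaled letters with `ℓ_k = c·β_k`).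
* §2 `abs_transport_tail_le_core_of_letters` (every `v`: `≤ 16·N⁸·(C/(N+1)⁶)·L₀² + C`), **`abs_transport_tail_sub_le_of_scaledLetters`** (all `v`:
  `≤ A_L/(‖v‖∞+1)⁷`, `A_L := 4⁷·(16·C·ℓ₀² + C) + (5/4)⁷·C·ℓ₀·(128·(4/3)⁷·ℓ₁ + 4096·16⁷·ℓ₇)`, FREE OF `N`),
  **`summable_weight_transport_tail_sub_of_scaledLetters`** ((T2) from the letters: `Summable`, `|Σ'| ≤ 161·A_L`, every finite window `≤ 161·A_L`).
* §3 **`summable_weight_transport_tail_sub_of_expL1`** — the (T2) socket under the exponentially weighted ℓ¹ profile (`ℓ₀ = c·e^δ`, `ℓ₁ = c·e^δ/δ`,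
  `ℓ₇ = 5040·c·e^δ/δ⁷`).
Unit `b2b-balaban-beta-d1-formalise-leaf-02` (gen 6).
-/

noncomputable section

namespace Summit.QuantumFields.BalabanUV.Beta.FP.HorizontalBookkeepingTailLetters

open Finset Filter Topology
open scoped BigOperators
open Literature.MathematicalPhysics.QuantumFieldTheory.Balaban1983to89
open Literature.MathematicalPhysics.QuantumFieldTheory.Balaban1983to89.Beta
open B12Sec2to5 (l1 l1_nonneg abs_coord_le_l1)
open ExpKernelCalculus (Site Zl Zl_pos l1_sub_triangle l1_sub_symm)
open DecimatedMomentSummable (dressedSum ConstReproSum)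
open DressedMomentNormalisation (EKer dressedEntry hasSum_total_of_constReproSum)
open Summit.QuantumFields.BalabanUV.Beta.FP.HorizontalBookkeeping (truncK truncK_apply)
open Summit.QuantumFields.BalabanUV.Beta.FP.HorizontalBookkeepingTail
open Summit.QuantumFields.BalabanUV.Beta.FP.HorizontalBookkeepingTailPointwise
open Summit.QuantumFields.BalabanUV.Beta.FP.HorizontalBookkeepingTailSum
open DyadicShell (Pt supNorm supNorm_eq_zero_iff natAbs_le_supNorm)

variable {D : ℕ}

/-! ## §1 Letters from an exponentially weighted ℓ¹ profile; the sup profile as a supplier of scaled letters -/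

/-- [folklore] `(L+1)^k ≤ (k!·e^{a}/a^k)·e^{aL}` for `L ≥ 0`, `a > 0`. -/
theorem pow_succ_le_exp {k : ℕ} {a L : ℝ} (ha : 0 < a) (hL : 0 ≤ L) :
    (L + 1) ^ k ≤ ((k.factorial : ℝ) * Real.exp a / a ^ k) * Real.exp (a * L) := by
  have h := StencilMoments.pow_succ_mul_exp_le k ha hL
  have hpos : 0 < Real.exp (-(2 * a) * L) := Real.exp_pos _
  have e : ((k.factorial : ℝ) * Real.exp a / a ^ k) * Real.exp (-a * L)
      = (((k.factorial : ℝ) * Real.exp a / a ^ k) * Real.exp (a * L)) * Real.exp (-(2 * a) * L) := by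
    rw [mul_assoc, ← Real.exp_add]; congr 2; ring
  rw [e] at h
  exact le_of_mul_le_mul_right h hpos

/-- **LETTERS FROM AN EXPONENTIALLY WEIGHTED ℓ¹ PROFILE**: `Σ'_x e^{(δ/N)|x|₁}·|w x| ≤ c/N` (summable; `δ > 0`, `N ≥ 1`) ⟹ for every `k`,
`Σ'_x (|x|₁+1)^k·|w x| ≤ c·(k!·e^{δ}/δ^k)·N^k/N` — the scalings `N⁻¹, N⁰, …, N⁶` of the letters (b-T) consumes. [folklore] -/
theorem letter_of_expL1 {w : Site D → ℝ} {c δ : ℝ} {N : ℕ} (hδ : 0 < δ) (hN : 1 ≤ N)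
    (hs : Summable fun x => Real.exp (δ / N * l1 x) * |w x|) (hb : ∑' x, Real.exp (δ / N * l1 x) * |w x| ≤ c / N) (k : ℕ) :
    Summable (fun x => (l1 x + 1) ^ k * |w x|)
      ∧ ∑' x, (l1 x + 1) ^ k * |w x| ≤ c * ((k.factorial : ℝ) * Real.exp δ / δ ^ k) * (N : ℝ) ^ k / N := by
  have hN' : (1 : ℝ) ≤ N := by exact_mod_cast hN
  have hNpos : (0 : ℝ) < N := by linarith
  have ha : 0 < δ / N := div_pos hδ hNpos
  set κ : ℝ := (k.factorial : ℝ) * Real.exp (δ / N) / (δ / N) ^ k with hκ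
  have hκ0 : 0 ≤ κ := by positivity
  have hpt : ∀ x, (l1 x + 1) ^ k * |w x| ≤ κ * (Real.exp (δ / N * l1 x) * |w x|) := by
    intro x
    rw [← mul_assoc]
    exact mul_le_mul_of_nonneg_right (pow_succ_le_exp ha (l1_nonneg x)) (abs_nonneg _)
  have hsum : Summable (fun x => (l1 x + 1) ^ k * |w x|) :=
    Summable.of_nonneg_of_le (fun x => mul_nonneg (pow_nonneg (by linarith [l1_nonneg x]) _) (abs_nonneg _)) hpt (hs.mul_left κ)
  refine ⟨hsum, ?_⟩
  have h1 : ∑' x, (l1 x + 1) ^ k * |w x| ≤ κ * (c / N) := by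
    calc ∑' x, (l1 x + 1) ^ k * |w x| ≤ ∑' x, κ * (Real.exp (δ / N * l1 x) * |w x|) := hsum.tsum_le_tsum hpt (hs.mul_left κ)
      _ = κ * ∑' x, Real.exp (δ / N * l1 x) * |w x| := tsum_mul_left
      _ ≤ κ * (c / N) := mul_le_mul_of_nonneg_left hb hκ0
  refine h1.trans ?_
  -- `κ = k!·e^{δ/N}·(N/δ)^k ≤ k!·e^{δ}·N^k/δ^k`
  have hc : 0 ≤ c := by
    have h0 : 0 ≤ ∑' x, Real.exp (δ / N * l1 x) * |w x| := tsum_nonneg fun x => by positivity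
    have := h0.trans hb
    rw [le_div_iff₀ hNpos, zero_mul] at this
    exact this
  have hexp : Real.exp (δ / N) ≤ Real.exp δ := Real.exp_le_exp.mpr (div_le_self hδ.le hN')
  have eκ : κ = (k.factorial : ℝ) * Real.exp (δ / N) / δ ^ k * (N : ℝ) ^ k := by
    rw [hκ, div_pow]; field_simp
  rw [eκ]
  have : (k.factorial : ℝ) * Real.exp (δ / N) / δ ^ k * (N : ℝ) ^ k * (c / N)
      ≤ (k.factorial : ℝ) * Real.exp δ / δ ^ k * (N : ℝ) ^ k * (c / N) := by gcongr
  refine this.trans (le_of_eq ?_)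
  ring

/-- [folklore] THE SUP PROFILE AS A SUPPLIER: `|w x| ≤ (c/N⁵)·e^{−(δ/N)|x|₁}` on `ℤ⁴` gives the scaled letters with `ℓ_k = c·k!·e^{δ/2}(2/δ)^k(1+4/δ)⁴`:
`Σ'|w| ≤ ℓ₀/N`, `Σ'(|x|₁+1)|w| ≤ ℓ₁`, `Σ'(|x|₁+1)⁷|w| ≤ ℓ₇·N⁶` (`letter_at_scale`). -/
theorem scaledLetters_of_supProfile {w : Pt → ℝ} {c δ : ℝ} {N : ℕ} (hδ : 0 < δ) (hN : 1 ≤ N) (hc : 0 ≤ c)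
    (hw : ∀ x, |w x| ≤ c / (N : ℝ) ^ 5 * Real.exp (-(δ / N) * l1 x)) :
    (Summable fun x => (l1 x + 1) ^ 7 * |w x|)
      ∧ ∑' x, |w x| ≤ c * (Real.exp (δ / 2) * (1 + 4 / δ) ^ 4) / N
      ∧ ∑' x, (l1 x + 1) * |w x| ≤ c * (Real.exp (δ / 2) * (2 / δ) * (1 + 4 / δ) ^ 4)
      ∧ ∑' x, (l1 x + 1) ^ 7 * |w x| ≤ c * ((5040 : ℝ) * Real.exp (δ / 2) * (2 / δ) ^ 7 * (1 + 4 / δ) ^ 4) * (N : ℝ) ^ 6 := by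
  have hN' : (1 : ℝ) ≤ N := by exact_mod_cast hN
  have hX : (0 : ℝ) < N := by linarith
  have hc' : 0 ≤ c / (N : ℝ) ^ 5 := by positivity
  have h0 := (letter_at_scale (D := 4) hδ hN hc' hw 0).2
  have h1 := (letter_at_scale (D := 4) hδ hN hc' hw 1).2
  have h7 := letter_at_scale (D := 4) hδ hN hc' hw 7
  simp only [pow_zero, one_mul, Nat.factorial_zero, Nat.cast_one, mul_one, zero_add] at h0
  simp only [pow_one, Nat.factorial_one, Nat.cast_one, one_mul] at h1
  have e7 : ((Nat.factorial 7 : ℕ) : ℝ) = 5040 := by norm_num [Nat.factorial]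
  rw [e7] at h7
  refine ⟨h7.1, ?_, ?_, ?_⟩
  · refine h0.trans (le_of_eq ?_); field_simp
  · refine h1.trans (le_of_eq ?_); field_simp
  · refine h7.2.trans (le_of_eq ?_); field_simp

/-! ## §2 The comparison from abstract scaled letters -/

/-- **CORE BOUND FROM THE MASS LETTER ALONE**: `|K| ≤ C(‖t‖∞+1)⁻⁶`, `Σ'|w κ l| ≤ L₀` (summable) ⟹ for every `v`,
`|N⁸·dressedEntry w (K − truncK K N) (N•v) a b − N⁶·(K − truncK K N) a b (N•v)| ≤ 16·N⁸·(C/(N+1)⁶)·L₀² + C`. [folklore] -/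
theorem abs_transport_tail_le_core_of_letters {K w : EKer 4} {C L₀ : ℝ} {N : ℕ} (hN : 1 ≤ N)
    (hK : ∀ c' e (t : Pt), |K c' e t| ≤ C / ((supNorm t : ℝ) + 1) ^ 6)
    (hwS : ∀ κ l, Summable fun x => |w κ l x|) (hL0 : ∀ κ l, ∑' x, |w κ l x| ≤ L₀) (a b : Fin 4) (v : Pt) :
    |(N : ℝ) ^ 8 * dressedEntry w (K - truncK K N) ((N : ℤ) • v) a b - (N : ℝ) ^ 6 * (K - truncK K N) a b ((N : ℤ) • v)|
      ≤ 16 * (N : ℝ) ^ 8 * (C / ((N : ℝ) + 1) ^ 6) * L₀ ^ 2 + C := by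
  have hN' : (1 : ℝ) ≤ N := by exact_mod_cast hN
  have hX : (0 : ℝ) < N := by linarith
  have hC := nonneg_of_decay hK a b
  set T : EKer 4 := K - truncK K N with hT
  set y : Pt := (N : ℤ) • v with hy
  set A : ℝ := C / ((N : ℝ) + 1) ^ 6 with hA
  have hA0 : 0 ≤ A := by positivity
  have hTA : ∀ c' e (t : Pt), |T c' e t| ≤ A := fun c' e t => abs_tail_le hK c' e t
  have n0 : ∀ κ l, 0 ≤ ∑' x, |w κ l x| := fun κ l => tsum_nonneg fun x => abs_nonneg _
  have hL0nn : 0 ≤ L₀ := (n0 a a).trans (hL0 a a)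
  have hfib : ∀ c' e, |dressedSum (w c' a) (T c' e) (w e b) y| ≤ A * L₀ ^ 2 := by
    intro c' e
    have hs := (hasSum_abs_mul_abs (hwS c' a) (hwS e b)).mul_left A
    have h1 : ‖∑' p : Pt × Pt, w c' a p.1 * T c' e (y + p.1 - p.2) * w e b p.2‖ ≤ _ :=
      tsum_of_norm_bounded hs (fun p => by
        rw [Real.norm_eq_abs, abs_mul, abs_mul]
        calc |w c' a p.1| * |T c' e (y + p.1 - p.2)| * |w e b p.2| ≤ |w c' a p.1| * A * |w e b p.2| := by
              gcongr; exact hTA c' e _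
          _ = A * (|w c' a p.1| * |w e b p.2|) := by ring)
    rw [Real.norm_eq_abs] at h1
    unfold dressedSum
    refine h1.trans ?_
    rw [sq]
    gcongr
    · exact hL0 c' a
    · exact hL0 e b
  have hfirst : |(N : ℝ) ^ 8 * dressedEntry w T y a b| ≤ 16 * (N : ℝ) ^ 8 * A * L₀ ^ 2 := by
    rw [abs_mul, abs_of_nonneg (by positivity : (0 : ℝ) ≤ (N : ℝ) ^ 8)]
    unfold dressedEntry
    have h16 : |∑ c', ∑ e, dressedSum (w c' a) (T c' e) (w e b) y| ≤ 16 * (A * L₀ ^ 2) := by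
      refine (Finset.abs_sum_le_sum_abs _ _).trans ?_
      calc ∑ c', |∑ e, dressedSum (w c' a) (T c' e) (w e b) y| ≤ ∑ _c' : Fin 4, 4 * (A * L₀ ^ 2) := by
            refine Finset.sum_le_sum fun c' _ => (Finset.abs_sum_le_sum_abs _ _).trans ?_
            calc ∑ e, |dressedSum (w c' a) (T c' e) (w e b) y| ≤ ∑ _e : Fin 4, A * L₀ ^ 2 := Finset.sum_le_sum fun e _ => hfib c' e
              _ = _ := by rw [Finset.sum_const, Finset.card_univ, Fintype.card_fin, nsmul_eq_mul]; norm_num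
        _ = _ := by rw [Finset.sum_const, Finset.card_univ, Fintype.card_fin, nsmul_eq_mul]; norm_num; ring
    calc (N : ℝ) ^ 8 * |∑ c', ∑ e, dressedSum (w c' a) (T c' e) (w e b) y| ≤ (N : ℝ) ^ 8 * (16 * (A * L₀ ^ 2)) :=
          mul_le_mul_of_nonneg_left h16 (by positivity)
      _ = 16 * (N : ℝ) ^ 8 * A * L₀ ^ 2 := by ring
  have hsecond : |(N : ℝ) ^ 6 * T a b y| ≤ C := by
    rw [abs_mul, abs_of_nonneg (by positivity : (0 : ℝ) ≤ (N : ℝ) ^ 6), hT, tail_apply]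
    split_ifs with h
    · rw [abs_zero, mul_zero]; exact hC
    · have hlt := not_le.mp h
      rw [hy, supNorm_natCast_smul] at hlt
      have hv1 : 1 ≤ supNorm v := by
        rcases Nat.eq_zero_or_pos (supNorm v) with h0 | h0
        · rw [h0, mul_zero] at hlt; exact absurd hlt (Nat.not_lt_zero _)
        · exact h0
      have hge : (N : ℝ) ≤ (supNorm y : ℝ) + 1 := by
        rw [hy, supNorm_natCast_smul]; push_cast
        have : (N : ℝ) * 1 ≤ (N : ℝ) * (supNorm v : ℝ) := mul_le_mul_of_nonneg_left (by exact_mod_cast hv1) hX.le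
        linarith
      calc (N : ℝ) ^ 6 * |K a b y| ≤ (N : ℝ) ^ 6 * (C / ((supNorm y : ℝ) + 1) ^ 6) := mul_le_mul_of_nonneg_left (hK a b y) (by positivity)
        _ ≤ (N : ℝ) ^ 6 * (C / (N : ℝ) ^ 6) := by gcongr
        _ = C := by field_simp
  calc |(N : ℝ) ^ 8 * dressedEntry w T y a b - (N : ℝ) ^ 6 * T a b y|
      ≤ |(N : ℝ) ^ 8 * dressedEntry w T y a b| + |(N : ℝ) ^ 6 * T a b y| := abs_sub _ _
    _ ≤ _ := add_le_add hfirst hsecond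

/-- **THE POINTWISE COMPARISON FROM ABSTRACT SCALED LETTERS, ALL `v`**: `|K| ≤ C(‖t‖∞+1)⁻⁶`, `|Δ_iK| ≤ C(‖t‖∞+1)⁻⁷`, Kronecker masses (L0∞)
`δ_{κl}N⁻⁵`, and the three ℓ¹ LETTERS with their scalings — `Σ'|w κ l| ≤ ℓ₀/N`, `Σ'(|x|₁+1)|w κ l x| ≤ ℓ₁`, `Σ'(|x|₁+1)⁷|w κ l x| ≤ ℓ₇·N⁶` (`N ≥ 1`) ⟹
`|N⁸·dressedEntry w (K − truncK K N) (N•v) a b − N⁶·(K − truncK K N) a b (N•v)| ≤ A_L/(‖v‖∞+1)⁷`,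
`A_L := 4⁷·(16·C·ℓ₀² + C) + (5/4)⁷·(C·ℓ₀·(128·(4/3)⁷·ℓ₁ + 4096·16⁷·ℓ₇))` — FREE OF `N`. [folklore] -/
theorem abs_transport_tail_sub_le_of_scaledLetters {K w : EKer 4} {C ℓ₀ ℓ₁ ℓ₇ : ℝ} {N : ℕ} (hN : 1 ≤ N)
    (hK : ∀ c' e (t : Pt), |K c' e t| ≤ C / ((supNorm t : ℝ) + 1) ^ 6)
    (hdK : ∀ c' e (t : Pt) (i : Fin 4), |K c' e (t + Pi.single i 1) - K c' e t| ≤ C / ((supNorm t : ℝ) + 1) ^ 7)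
    (hw0 : ∀ κ l, ConstReproSum N (w κ l) (if κ = l then (((N : ℝ) ^ (4 + 1))⁻¹) else 0))
    (hwS : ∀ κ l, Summable fun x => (l1 x + 1) ^ 7 * |w κ l x|)
    (hL0 : ∀ κ l, ∑' x, |w κ l x| ≤ ℓ₀ / N) (hL1 : ∀ κ l, ∑' x, (l1 x + 1) * |w κ l x| ≤ ℓ₁)
    (hL7 : ∀ κ l, ∑' x, (l1 x + 1) ^ 7 * |w κ l x| ≤ ℓ₇ * (N : ℝ) ^ 6) (a b : Fin 4) (v : Pt) :
    |(N : ℝ) ^ 8 * dressedEntry w (K - truncK K N) ((N : ℤ) • v) a b - (N : ℝ) ^ 6 * (K - truncK K N) a b ((N : ℤ) • v)|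
      ≤ ((4 : ℝ) ^ 7 * (16 * C * ℓ₀ ^ 2 + C) + (5 / 4 : ℝ) ^ 7 * (C * ℓ₀ * (128 * (4 / 3 : ℝ) ^ 7 * ℓ₁ + 4096 * 16 ^ 7 * ℓ₇)))
        / ((supNorm v : ℝ) + 1) ^ 7 := by
  have hN' : (1 : ℝ) ≤ N := by exact_mod_cast hN
  have hX : (0 : ℝ) < N := by linarith
  have hC := nonneg_of_decay hK a b
  have n0 : ∀ κ l, 0 ≤ ∑' x, |w κ l x| := fun κ l => tsum_nonneg fun x => abs_nonneg _
  have n1 : ∀ κ l, 0 ≤ ∑' x, (l1 x + 1) * |w κ l x| := fun κ l =>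
    tsum_nonneg fun x => mul_nonneg (by linarith [l1_nonneg x]) (abs_nonneg _)
  have n7 : ∀ κ l, 0 ≤ ∑' x, (l1 x + 1) ^ 7 * |w κ l x| := fun κ l =>
    tsum_nonneg fun x => mul_nonneg (pow_nonneg (by linarith [l1_nonneg x]) _) (abs_nonneg _)
  have hℓ0 : 0 ≤ ℓ₀ := by
    have := (n0 a a).trans (hL0 a a); rw [le_div_iff₀ hX, zero_mul] at this; exact this
  have hℓ1 : 0 ≤ ℓ₁ := (n1 a a).trans (hL1 a a)
  have hℓ7 : 0 ≤ ℓ₇ := by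
    have h := (n7 a a).trans (hL7 a a)
    exact le_of_mul_le_mul_right (by rwa [zero_mul]) (pow_pos hX 6)
  set Acore : ℝ := 16 * C * ℓ₀ ^ 2 + C with hAcore
  set Aout : ℝ := C * ℓ₀ * (128 * (4 / 3 : ℝ) ^ 7 * ℓ₁ + 4096 * 16 ^ 7 * ℓ₇) with hAout
  have hAcore0 : 0 ≤ Acore := by positivity
  have hAout0 : 0 ≤ Aout := by positivity
  set n : ℝ := (supNorm v : ℝ) with hn
  have hn0 : 0 ≤ n := by positivity
  by_cases hv : 4 ≤ supNorm v
  · have hmain := abs_transport_tail_sub_le_of_letters hN hK hdK hw0 hwS hL0 hL1 hL7 a b hv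
    refine hmain.trans ?_
    obtain ⟨hρ1, _, hρ16⟩ := rho_bounds hN hv
    set X : ℝ := (N : ℝ) with hXdef
    set ρ : ℝ := ((N * (supNorm v / 4) : ℕ) : ℝ) with hρdef
    have hn4 : (4 : ℝ) ≤ n := by rw [hn]; exact_mod_cast hv
    have hρpos : (0 : ℝ) < ρ := by rw [hρdef]; exact_mod_cast hρ1
    have h16 : X * n ≤ 16 * ρ := by rw [hXdef, hn, hρdef]; exact_mod_cast hρ16
    have t1 : 16 * X ^ 8 * (4 * (C * (4 / 3 : ℝ) ^ 7 / (X * n) ^ 7) * (2 * ℓ₁ * (ℓ₀ / X)))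
        = C * ℓ₀ * (128 * (4 / 3 : ℝ) ^ 7 * ℓ₁) / n ^ 7 := by
      field_simp
      ring
    have t2 : 16 * X ^ 8 * (128 * (C / (X + 1) ^ 6) / ρ ^ 7 * (2 * (ℓ₇ * X ^ 6) * (ℓ₀ / X)))
        ≤ C * ℓ₀ * (4096 * 16 ^ 7 * ℓ₇) / n ^ 7 := by
      have key : X ^ 13 * n ^ 7 ≤ (X + 1) ^ 6 * (16 * ρ) ^ 7 := by
        rw [show X ^ 13 * n ^ 7 = X ^ 6 * (X * n) ^ 7 by ring]
        exact mul_le_mul (pow_le_pow_left₀ hX.le (by linarith) 6) (pow_le_pow_left₀ (by positivity) h16 7)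
          (by positivity) (by positivity)
      have lhs : 16 * X ^ 8 * (128 * (C / (X + 1) ^ 6) / ρ ^ 7 * (2 * (ℓ₇ * X ^ 6) * (ℓ₀ / X)))
          = (C * ℓ₀ * (4096 * ℓ₇)) * (X ^ 13 / ((X + 1) ^ 6 * ρ ^ 7)) := by
        field_simp; ring
      have rhs : C * ℓ₀ * (4096 * 16 ^ 7 * ℓ₇) / n ^ 7 = (C * ℓ₀ * (4096 * ℓ₇)) * (16 ^ 7 / n ^ 7) := by ring
      rw [lhs, rhs]
      refine mul_le_mul_of_nonneg_left ?_ (by positivity)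
      rw [div_le_div_iff₀ (by positivity) (by positivity)]
      calc X ^ 13 * n ^ 7 ≤ (X + 1) ^ 6 * (16 * ρ) ^ 7 := key
        _ = 16 ^ 7 * ((X + 1) ^ 6 * ρ ^ 7) := by ring
    have hout : 16 * X ^ 8 * (4 * (C * (4 / 3 : ℝ) ^ 7 / (X * n) ^ 7) * (2 * ℓ₁ * (ℓ₀ / X))
          + 128 * (C / (X + 1) ^ 6) / ρ ^ 7 * (2 * (ℓ₇ * X ^ 6) * (ℓ₀ / X))) ≤ Aout / n ^ 7 := by
      rw [mul_add (16 * X ^ 8), t1]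
      have split : Aout / n ^ 7 = C * ℓ₀ * (128 * (4 / 3 : ℝ) ^ 7 * ℓ₁) / n ^ 7 + C * ℓ₀ * (4096 * 16 ^ 7 * ℓ₇) / n ^ 7 := by
        rw [hAout]; ring
      rw [split]
      linarith
    refine hout.trans ?_
    have h1 : Aout / n ^ 7 ≤ (5 / 4 : ℝ) ^ 7 * Aout / (n + 1) ^ 7 := by
      rw [div_le_div_iff₀ (by positivity) (by positivity)]
      have key : (n + 1) ^ 7 ≤ ((5 / 4 : ℝ) * n) ^ 7 := pow_le_pow_left₀ (by positivity) (by linarith) 7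
      calc Aout * (n + 1) ^ 7 ≤ Aout * ((5 / 4 : ℝ) * n) ^ 7 := mul_le_mul_of_nonneg_left key hAout0
        _ = (5 / 4 : ℝ) ^ 7 * Aout * n ^ 7 := by ring
    refine h1.trans ?_
    rw [div_le_div_iff_of_pos_right (by positivity)]
    have : 0 ≤ (4 : ℝ) ^ 7 * Acore := by positivity
    linarith
  · have hwS0 : ∀ κ l, Summable fun x => |w κ l x| := fun κ l => by
      simpa using summable_weight_of_le (hwS κ l) (k := 0) (by norm_num)
    have h := abs_transport_tail_le_core_of_letters hN hK hwS0 hL0 a b v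
    refine h.trans ?_
    have hn3 : n ≤ 3 := by
      have : supNorm v ≤ 3 := by omega
      rw [hn]; exact_mod_cast this
    -- `16 N⁸ (C/(N+1)⁶) (ℓ₀/N)² ≤ 16 C ℓ₀²`
    have hfrac : (N : ℝ) ^ 8 * (1 / ((N : ℝ) + 1) ^ 6) * (1 / (N : ℝ)) ^ 2 ≤ 1 := by
      rw [show (N : ℝ) ^ 8 * (1 / ((N : ℝ) + 1) ^ 6) * (1 / (N : ℝ)) ^ 2 = (N : ℝ) ^ 6 / ((N : ℝ) + 1) ^ 6 by field_simp]
      rw [div_le_one (by positivity)]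
      exact pow_le_pow_left₀ hX.le (by linarith) 6
    have hcore : 16 * (N : ℝ) ^ 8 * (C / ((N : ℝ) + 1) ^ 6) * (ℓ₀ / N) ^ 2 + C ≤ Acore := by
      rw [hAcore]
      have e : 16 * (N : ℝ) ^ 8 * (C / ((N : ℝ) + 1) ^ 6) * (ℓ₀ / N) ^ 2
          = (16 * C * ℓ₀ ^ 2) * ((N : ℝ) ^ 8 * (1 / ((N : ℝ) + 1) ^ 6) * (1 / (N : ℝ)) ^ 2) := by ring
      rw [e]
      have := mul_le_mul_of_nonneg_left hfrac (by positivity : (0 : ℝ) ≤ 16 * C * ℓ₀ ^ 2)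
      linarith
    refine hcore.trans ?_
    rw [le_div_iff₀ (by positivity)]
    have key : (n + 1) ^ 7 ≤ (4 : ℝ) ^ 7 := pow_le_pow_left₀ (by positivity) (by linarith) 7
    have : 0 ≤ (5 / 4 : ℝ) ^ 7 * Aout := by positivity
    calc Acore * (n + 1) ^ 7 ≤ Acore * (4 : ℝ) ^ 7 := mul_le_mul_of_nonneg_left key hAcore0
      _ ≤ (4 : ℝ) ^ 7 * Acore + (5 / 4 : ℝ) ^ 7 * Aout := by linarith

/-- **(T2) FROM ABSTRACT SCALED LETTERS**: with `A_L` as above, the `((v μ·v ν : ℤ) : ℝ)`-weighted difference is `≤ A_L·(‖v‖∞+1)⁻⁵`, summable on `ℤ⁴`,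
`|Σ'| ≤ 161·A_L`, and `|Σ_{v∈S}| ≤ 161·A_L` for every finite window `S` — uniformly in `N ≥ 1`. [folklore] -/
theorem summable_weight_transport_tail_sub_of_scaledLetters {K w : EKer 4} {C ℓ₀ ℓ₁ ℓ₇ : ℝ} {N : ℕ} (hN : 1 ≤ N)
    (hK : ∀ c' e (t : Pt), |K c' e t| ≤ C / ((supNorm t : ℝ) + 1) ^ 6)
    (hdK : ∀ c' e (t : Pt) (i : Fin 4), |K c' e (t + Pi.single i 1) - K c' e t| ≤ C / ((supNorm t : ℝ) + 1) ^ 7)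
    (hw0 : ∀ κ l, ConstReproSum N (w κ l) (if κ = l then (((N : ℝ) ^ (4 + 1))⁻¹) else 0))
    (hwS : ∀ κ l, Summable fun x => (l1 x + 1) ^ 7 * |w κ l x|)
    (hL0 : ∀ κ l, ∑' x, |w κ l x| ≤ ℓ₀ / N) (hL1 : ∀ κ l, ∑' x, (l1 x + 1) * |w κ l x| ≤ ℓ₁)
    (hL7 : ∀ κ l, ∑' x, (l1 x + 1) ^ 7 * |w κ l x| ≤ ℓ₇ * (N : ℝ) ^ 6) (a b μ ν : Fin 4) :
    let AL : ℝ := (4 : ℝ) ^ 7 * (16 * C * ℓ₀ ^ 2 + C) + (5 / 4 : ℝ) ^ 7 * (C * ℓ₀ * (128 * (4 / 3 : ℝ) ^ 7 * ℓ₁ + 4096 * 16 ^ 7 * ℓ₇))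
    let g : Pt → ℝ := fun v => ((v μ * v ν : ℤ) : ℝ)
          * ((N : ℝ) ^ 8 * dressedEntry w (K - truncK K N) ((N : ℤ) • v) a b - (N : ℝ) ^ 6 * (K - truncK K N) a b ((N : ℤ) • v))
    (∀ v, |g v| ≤ AL / ((supNorm v : ℝ) + 1) ^ 5)
      ∧ Summable g ∧ |∑' v, g v| ≤ 161 * AL ∧ ∀ S : Finset Pt, |∑ v ∈ S, g v| ≤ 161 * AL := by
  intro AL g
  have hN' : (1 : ℝ) ≤ N := by exact_mod_cast hN
  have hX : (0 : ℝ) < N := by linarith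
  have hC := nonneg_of_decay hK a b
  have n0 : 0 ≤ ∑' x, |w a a x| := tsum_nonneg fun x => abs_nonneg _
  have n1 : 0 ≤ ∑' x, (l1 x + 1) * |w a a x| := tsum_nonneg fun x => mul_nonneg (by linarith [l1_nonneg x]) (abs_nonneg _)
  have n7 : 0 ≤ ∑' x, (l1 x + 1) ^ 7 * |w a a x| :=
    tsum_nonneg fun x => mul_nonneg (pow_nonneg (by linarith [l1_nonneg x]) _) (abs_nonneg _)
  have hℓ0 : 0 ≤ ℓ₀ := by
    have := n0.trans (hL0 a a); rw [le_div_iff₀ hX, zero_mul] at this; exact this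
  have hℓ1 : 0 ≤ ℓ₁ := n1.trans (hL1 a a)
  have hℓ7 : 0 ≤ ℓ₇ := by
    have h := n7.trans (hL7 a a)
    exact le_of_mul_le_mul_right (by rwa [zero_mul]) (pow_pos hX 6)
  have hAL : 0 ≤ AL := by positivity
  have hpt : ∀ v, |g v| ≤ AL / ((supNorm v : ℝ) + 1) ^ 5 := by
    intro v
    have h := abs_transport_tail_sub_le_of_scaledLetters hN hK hdK hw0 hwS hL0 hL1 hL7 a b v
    have hcoord : ∀ i : Fin 4, |((v i : ℤ) : ℝ)| ≤ (supNorm v : ℝ) + 1 := by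
      intro i
      have h1 : ((v i).natAbs : ℝ) ≤ (supNorm v : ℝ) := by exact_mod_cast natAbs_le_supNorm v i
      have e : (((v i).natAbs : ℕ) : ℝ) = |((v i : ℤ) : ℝ)| := by rw [Nat.cast_natAbs]; push_cast; rfl
      rw [← e]; linarith
    have hn : (0 : ℝ) < (supNorm v : ℝ) + 1 := by positivity
    show |((v μ * v ν : ℤ) : ℝ) * _| ≤ _
    rw [abs_mul, Int.cast_mul, abs_mul]
    calc |((v μ : ℤ) : ℝ)| * |((v ν : ℤ) : ℝ)| * _ ≤ ((supNorm v : ℝ) + 1) * ((supNorm v : ℝ) + 1) * (AL / ((supNorm v : ℝ) + 1) ^ 7) :=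
          mul_le_mul (mul_le_mul (hcoord μ) (hcoord ν) (abs_nonneg _) hn.le) h (abs_nonneg _) (by positivity)
      _ = AL / ((supNorm v : ℝ) + 1) ^ 5 := by field_simp
  exact ⟨hpt, summable_of_quintic hAL hpt⟩

/-! ## §3 The exponentially weighted ℓ¹ profile as the supplier -/

/-- **(T2) UNDER THE EXPONENTIALLY WEIGHTED ℓ¹ PROFILE** `Σ'_x e^{(δ/N)|x|₁}·|w κ l x| ≤ c/N` (summable; `δ > 0`, `N ≥ 1`): the letters are
`ℓ₀ = c·e^δ`, `ℓ₁ = c·e^δ/δ`, `ℓ₇ = 5040·c·e^δ/δ⁷` (`letter_of_expL1`), hence the `((v μ·v ν : ℤ) : ℝ)`-weighted tail-transport difference is summable on `ℤ⁴`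
with `|Σ'| ≤ 161·A_E` and every finite window `≤ 161·A_E`,
`A_E := 4⁷·(16·C·(c·e^δ)² + C) + (5/4)⁷·(C·(c·e^δ)·(128·(4/3)⁷·(c·e^δ/δ) + 4096·16⁷·(5040·c·e^δ/δ⁷)))` — free of `N`. [folklore] -/
theorem summable_weight_transport_tail_sub_of_expL1 {K w : EKer 4} {C c δ : ℝ} {N : ℕ} (hN : 1 ≤ N) (hδ : 0 < δ)
    (hK : ∀ c' e (t : Pt), |K c' e t| ≤ C / ((supNorm t : ℝ) + 1) ^ 6)
    (hdK : ∀ c' e (t : Pt) (i : Fin 4), |K c' e (t + Pi.single i 1) - K c' e t| ≤ C / ((supNorm t : ℝ) + 1) ^ 7)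
    (hw0 : ∀ κ l, ConstReproSum N (w κ l) (if κ = l then (((N : ℝ) ^ (4 + 1))⁻¹) else 0))
    (hwE : ∀ κ l, Summable fun x => Real.exp (δ / N * l1 x) * |w κ l x|)
    (hwEb : ∀ κ l, ∑' x, Real.exp (δ / N * l1 x) * |w κ l x| ≤ c / N) (a b μ ν : Fin 4) :
    let AE : ℝ := (4 : ℝ) ^ 7 * (16 * C * (c * Real.exp δ) ^ 2 + C)
        + (5 / 4 : ℝ) ^ 7 * (C * (c * Real.exp δ) * (128 * (4 / 3 : ℝ) ^ 7 * (c * Real.exp δ / δ) + 4096 * 16 ^ 7 * (5040 * c * Real.exp δ / δ ^ 7)))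
    let g : Pt → ℝ := fun v => ((v μ * v ν : ℤ) : ℝ)
          * ((N : ℝ) ^ 8 * dressedEntry w (K - truncK K N) ((N : ℤ) • v) a b - (N : ℝ) ^ 6 * (K - truncK K N) a b ((N : ℤ) • v))
    (∀ v, |g v| ≤ AE / ((supNorm v : ℝ) + 1) ^ 5)
      ∧ Summable g ∧ |∑' v, g v| ≤ 161 * AE ∧ ∀ S : Finset Pt, |∑ v ∈ S, g v| ≤ 161 * AE := by
  intro AE g
  have hN' : (1 : ℝ) ≤ N := by exact_mod_cast hN
  have hX : (0 : ℝ) < N := by linarith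
  -- the three letters
  have hwS : ∀ κ l, Summable fun x => (l1 x + 1) ^ 7 * |w κ l x| := fun κ l => (letter_of_expL1 hδ hN (hwE κ l) (hwEb κ l) 7).1
  have hL0 : ∀ κ l, ∑' x, |w κ l x| ≤ c * Real.exp δ / N := by
    intro κ l
    have h := (letter_of_expL1 (D := 4) hδ hN (hwE κ l) (hwEb κ l) 0).2
    simp only [pow_zero, one_mul, Nat.factorial_zero, Nat.cast_one, div_one, mul_one] at h
    exact h
  have hL1 : ∀ κ l, ∑' x, (l1 x + 1) * |w κ l x| ≤ c * Real.exp δ / δ := by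
    intro κ l
    have h := (letter_of_expL1 (D := 4) hδ hN (hwE κ l) (hwEb κ l) 1).2
    simp only [pow_one, Nat.factorial_one, Nat.cast_one, one_mul] at h
    refine h.trans (le_of_eq ?_)
    field_simp
  have hL7 : ∀ κ l, ∑' x, (l1 x + 1) ^ 7 * |w κ l x| ≤ 5040 * c * Real.exp δ / δ ^ 7 * (N : ℝ) ^ 6 := by
    intro κ l
    have h := (letter_of_expL1 (D := 4) hδ hN (hwE κ l) (hwEb κ l) 7).2
    have e7 : ((Nat.factorial 7 : ℕ) : ℝ) = 5040 := by norm_num [Nat.factorial]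
    rw [e7] at h
    refine h.trans (le_of_eq ?_)
    field_simp
  exact summable_weight_transport_tail_sub_of_scaledLetters hN hK hdK hw0 hwS hL0 hL1 hL7 a b μ ν

end Summit.QuantumFields.BalabanUV.Beta.FP.HorizontalBookkeepingTailLetters

end
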